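import Summits.SmoothPoincare4.SmoothPoincare4.Theorems.CylinderEntropyImmortalAreaToFloorCutPieceDensity
import Summits.SmoothPoincare4.SmoothPoincare4.Theorems.CylinderEntropyImmortalAreaToFloorCutoff
import Summits.SmoothPoincare4.SmoothPoincare4.Theorems.CylinderEntropyImmortalAreaToFloorGoodPointBounds
import Summits.SmoothPoincare4.SmoothPoincare4.Theorems.CylinderEntropyImmortalAreaToFloorInitialDensity
import Summits.SmoothPoincare4.SmoothPoincare4.Theorems.CylinderEntropyImmortalAreaToFloorStacking
import HarnessLib

/-!
# Route `CylinderEntropy`, item `ImmortalAreaToFloor` (stmt-SmoothPoincare4-17197):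
# NO TWO GOOD POINTS ON ONE VERTICAL (module Γ6 of `BLUEPRINT-17197-c2.md`, geometric instantiation)

For a closed embedded cross-section `f : M⁴ → N = S⁴ × ℝ ⊂ ℝ⁶` with smooth unit normal `ν` tangent
to `N` and mean curvature `H`, the theorem `noTwoGoodPoints` derives `False` from the existence of
two points `y₁, y₂ ∈ M` with the SAME SHADOW in `S⁴` and heights `z₁ < z₂ = z₁ + g`, both GOOD up to
radius `R₀` (relative smallness of the tilt density `|ν'|² = ∑_{i<5} νᵢ²` with threshold `ξ` and of
`H²` with threshold `θ` on all balls of radius `≤ R₀` centred at them), given: quartic (Ahlfors) area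
growth at centres on `N` up to radius `R₀`, a total area bound `A_tot`, a Willmore bound
`∫ H² ≤ W`, the UPPER Gaussian density bound `∫ G_τ(p) ≤ 2 - δ₀` at centres `p ∈ N` and scales
`τ ≤ τ_max` (from entropy `< 2`), the height cutoffs with constants `c₁, c₂`
(`exists_heightCutoff`), and the numeric smallness conditions of `stacking_arith` for the chosen
scales `σ₀ ≤ σ₁`, near radius `ρ ≤ R₀`, aperture `η` and AM–GM parameter `κ`.
It instantiates, at the two points, the landed bricks: `gaussianMass_le_of_ballGrowth`,
`gaussianWillmore_le_of_ballGoodness` (constants `C_G`, `K_H`), `cutPiece_twoScale` (with the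
complementary cutoffs `u`, `1 - u`), `initialDensity_ge`, `midpoint_density_ge` (midpoint
`p = f y₁ + (g/2) e₅ ∈ N`), and closes with `stacking_arith`.

References: W. K. Allard, Ann. of Math. 95 (1972) §6; L. Simon, *Lectures on GMT* (1983) §17.
-/

-- the prescribed namespace `Summit.SmoothPoincare4.SmoothPoincare4.…` repeats `SmoothPoincare4`
set_option linter.dupNamespace false

noncomputable section

open Bundle Set Function Filter MeasureTheory Module
open scoped Manifold ContDiff Topology RealInnerProductSpace BigOperators

namespace Summit.SmoothPoincare4.SmoothPoincare4.Cruxes.CylinderRungTwo.KillingFlux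

open Literature.Geometry.Riemannian Literature.Geometry.Riemannian.EuclideanHypersurface
open Literature.Geometry.Lorentzian Literature.Geometry.Lorentzian.PseudoRiemannianMetric
open Summit.SmoothPoincare4.SmoothPoincare4.Theorems.GaussianBounds

/-- **The midpoint of two points on one vertical.**  If `x₁, x₂ ∈ ℝ⁶` have the same first five
coordinates and `g = (x₂)₅ - (x₁)₅`, then `p = x₁ + (g/2) e₅` has the same first five coordinates
and `‖x₁ - p‖ = ‖x₂ - p‖ = |g|/2`. [folklore] -/
theorem midpoint_vertical (x₁ x₂ : EuclideanSpace ℝ (Fin 6))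
    (hsh : ∀ i : Fin 5, x₁ (Fin.castSucc i) = x₂ (Fin.castSucc i)) :
    (∀ i : Fin 5, (x₁ + ((x₂ 5 - x₁ 5) / 2) • EuclideanSpace.single (5 : Fin 6) (1 : ℝ)) (Fin.castSucc i) =
        x₁ (Fin.castSucc i)) ∧
      ‖x₁ - (x₁ + ((x₂ 5 - x₁ 5) / 2) • EuclideanSpace.single (5 : Fin 6) (1 : ℝ))‖ =
        |x₂ 5 - x₁ 5| / 2 ∧
      ‖x₂ - (x₁ + ((x₂ 5 - x₁ 5) / 2) • EuclideanSpace.single (5 : Fin 6) (1 : ℝ))‖ =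
        |x₂ 5 - x₁ 5| / 2 := by
  set g : ℝ := x₂ 5 - x₁ 5 with hg
  set e₅ : EuclideanSpace ℝ (Fin 6) := EuclideanSpace.single (5 : Fin 6) (1 : ℝ) with he₅
  have h5 : (Fin.last 5 : Fin 6) = 5 := rfl
  have hne : ∀ i : Fin 5, (Fin.castSucc i : Fin 6) ≠ 5 := fun i => by
    rw [← h5]; exact (Fin.castSucc_lt_last i).ne
  have he5c : ∀ i : Fin 5, e₅ (Fin.castSucc i) = 0 := fun i => by
    simp [he₅, hne i]
  have he55 : e₅ 5 = 1 := by simp [he₅]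
  have hnorm : ‖e₅‖ = 1 := by simp [he₅]
  have hdiff : x₂ - x₁ = g • e₅ := by
    ext j
    refine Fin.lastCases ?_ (fun i => ?_) j
    · rw [h5]
      simp only [PiLp.sub_apply, PiLp.smul_apply, smul_eq_mul, he55, mul_one, hg]
    · simp only [PiLp.sub_apply, PiLp.smul_apply, smul_eq_mul, he5c, mul_zero, hsh i, sub_self]
  refine ⟨fun i => ?_, ?_, ?_⟩
  · simp only [PiLp.add_apply, PiLp.smul_apply, smul_eq_mul, he5c, mul_zero, add_zero]
  · have : x₁ - (x₁ + (g / 2) • e₅) = -((g / 2) • e₅) := by abel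
    rw [this, norm_neg, norm_smul, hnorm, mul_one, Real.norm_eq_abs, abs_div, abs_two]
  · have : x₂ - (x₁ + (g / 2) • e₅) = (x₂ - x₁) - (g / 2) • e₅ := by abel
    rw [this, hdiff, ← sub_smul, show g - g / 2 = g / 2 by ring, norm_smul, hnorm, mul_one,
      Real.norm_eq_abs, abs_div, abs_two]

variable {M : Type} [TopologicalSpace M] [ChartedSpace (EuclideanSpace ℝ (Fin 4)) M]
  [IsManifold (𝓡 4) ∞ M] [CompactSpace M] [T2Space M] [MeasurableSpace M] [BorelSpace M]

/-- **No two good points on one vertical.**  See the module docstring for the list of hypotheses;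
the conclusion is `False`. [cite: Allard1972, §6] -/
theorem noTwoGoodPoints {f νf : M → EuclideanSpace ℝ (Fin 6)}
    (hf : (euclideanMetric (EuclideanSpace ℝ (Fin 6))).IsSpacelikeImmersion (𝓡 4) f)
    (hemb : Manifold.IsSmoothEmbedding (𝓡 4) (𝓡 6) ∞ f)
    (hν : ContMDiff (𝓡 4) 𝓘(ℝ, EuclideanSpace ℝ (Fin 6)) ∞ νf)
    (hun : (euclideanMetric (EuclideanSpace ℝ (Fin 6))).IsUnitNormal (𝓡 4) f νf 1)
    (hN : ∀ x, ∑ i : Fin 5, f x (Fin.castSucc i) ^ 2 = 1)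
    (hνN : ∀ x, ∑ i : Fin 5, νf x (Fin.castSucc i) * f x (Fin.castSucc i) = 0)
    {δ₀ τmax R₀ CA CG Atot W ξ θ c₁ c₂ σ₀ σ₁ ρ η κ : ℝ}
    (hδ₀ : 0 < δ₀) (hδ₁ : δ₀ ≤ 1) (hR₀ : 0 < R₀) (hCA : 0 ≤ CA) (hξ : 0 < ξ) (hθ : 0 ≤ θ)
    (hσ₀ : 0 < σ₀) (hσ : σ₀ ≤ σ₁) (hρ : 0 < ρ) (hρR : ρ ≤ R₀) (hη : 0 < η) (hκ : 0 < κ)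
    (hτ : (1 + η) * σ₁ ≤ τmax)
    -- the cutoffs
    (hcut : ∀ a g : ℝ, 0 < g → ∃ u : ℝ → ℝ, ContDiff ℝ 2 u ∧ (∀ t, 0 ≤ u t ∧ u t ≤ 1) ∧
      (∀ t, |deriv u t| ≤ c₁ / g) ∧ (∀ t, |deriv (deriv u) t| ≤ c₂ / g ^ 2) ∧
      (∀ t, t ≤ a - g / 3 → u t = 1) ∧ (∀ t, a ≤ t → u t = 0))
    -- Ahlfors growth at centres on `N`, total area, Willmore energy
    (hAhl : ∀ y : EuclideanSpace ℝ (Fin 6), ∑ i : Fin 5, y (Fin.castSucc i) ^ 2 = 1 →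
      ∀ r, 0 < r → r ≤ R₀ →
        (riemannianMeasure ((euclideanMetric (EuclideanSpace ℝ (Fin 6))).inducedRiemannianMetric f
          contMDiff_pullbackBilin_holds hf)).real (f ⁻¹' Metric.closedBall y r) ≤ CA * r ^ 4)
    (hAtot : (riemannianMeasure ((euclideanMetric (EuclideanSpace ℝ (Fin 6))).inducedRiemannianMetric f
          contMDiff_pullbackBilin_holds hf)).real univ ≤ Atot)
    (hCG : 2048 * Real.exp (1 / 16) * CA / Real.pi ^ 2 + Atot / R₀ ^ 4 ≤ CG)
    (hW : ∫ w, (euclideanMetric (EuclideanSpace ℝ (Fin 6))).meanCurvature f contMDiff_pullbackBilin_holds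
          hf νf w ^ 2
        ∂riemannianMeasure ((euclideanMetric (EuclideanSpace ℝ (Fin 6))).inducedRiemannianMetric f
          contMDiff_pullbackBilin_holds hf) ≤ W)
    -- the upper Gaussian density bound at centres on `N` and scales `≤ τmax`
    (hup : ∀ p : EuclideanSpace ℝ (Fin 6), ∑ i : Fin 5, p (Fin.castSucc i) ^ 2 = 1 →
      ∀ τ, 0 < τ → τ ≤ τmax →
        ∫ w, Real.exp (-‖f w - p‖ ^ 2 / (4 * τ)) / (4 * Real.pi * τ) ^ 2
          ∂riemannianMeasure ((euclideanMetric (EuclideanSpace ℝ (Fin 6))).inducedRiemannianMetric f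
            contMDiff_pullbackBilin_holds hf) ≤ 2 - δ₀)
    -- the two points: same shadow, heights `z₁ < z₂`, both good up to radius `R₀`
    (y₁ y₂ : M) (hsh : ∀ i : Fin 5, f y₁ (Fin.castSucc i) = f y₂ (Fin.castSucc i))
    (hz : f y₁ 5 < f y₂ 5)
    (hgood : ∀ y ∈ ({y₁, y₂} : Set M), ∀ r, 0 < r → r ≤ R₀ →
      (∫ w in f ⁻¹' Metric.closedBall (f y) r, (∑ i : Fin 5, νf w (Fin.castSucc i) ^ 2)
          ∂riemannianMeasure ((euclideanMetric (EuclideanSpace ℝ (Fin 6))).inducedRiemannianMetric f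
            contMDiff_pullbackBilin_holds hf) ≤
        ξ * (riemannianMeasure ((euclideanMetric (EuclideanSpace ℝ (Fin 6))).inducedRiemannianMetric f
          contMDiff_pullbackBilin_holds hf)).real (f ⁻¹' Metric.closedBall (f y) r)) ∧
      (∫ w in f ⁻¹' Metric.closedBall (f y) r,
          (euclideanMetric (EuclideanSpace ℝ (Fin 6))).meanCurvature f contMDiff_pullbackBilin_holds
            hf νf w ^ 2
          ∂riemannianMeasure ((euclideanMetric (EuclideanSpace ℝ (Fin 6))).inducedRiemannianMetric f
            contMDiff_pullbackBilin_holds hf) ≤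
        θ * (riemannianMeasure ((euclideanMetric (EuclideanSpace ℝ (Fin 6))).inducedRiemannianMetric f
          contMDiff_pullbackBilin_holds hf)).real (f ⁻¹' Metric.closedBall (f y) r)))
    -- numeric smallness, with `g = z₂ - z₁`, `K_H = 2048 e^{1/16} θ C_A/π² + W/R₀⁴`
    (hm : 1 - δ₀ / 8 ≤ (1 + η)⁻¹ ^ 2 *
      Real.exp (-((1 + η⁻¹) * ((f y₂ 5 - f y₁ 5) / 2) ^ 2) / (4 * ((1 + η) * σ₁))))
    (hE : 1 - δ₀ / 16 ≤ Real.exp (-(4 * σ₁)))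
    (ha : Real.exp (4 * σ₀) * ((2048 * Real.exp (1 / 16) * (θ * CA) / Real.pi ^ 2 + W / R₀ ^ 4) / 4) * σ₀ +
      4 * Real.exp (4 * σ₀) * Real.exp (-(f y₂ 5 - f y₁ 5) ^ 2 / (72 * σ₀)) * CG ≤ δ₀ / 16)
    (hK : ((2048 * Real.exp (1 / 16) * (θ * CA) / Real.pi ^ 2 + W / R₀ ^ 4) / 4
        + c₂ / (f y₂ 5 - f y₁ 5) ^ 2 *
          ((1 / (4 * Real.pi * σ₀) ^ 2) * (ξ * (CA * ρ ^ 4)) + 4 * Real.exp (-ρ ^ 2 / (8 * σ₁)) * CG)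
        + c₁ / (f y₂ 5 - f y₁ 5) *
          ((1 / 2) * (2048 * Real.exp (1 / 16) * (θ * CA) / Real.pi ^ 2 + W / R₀ ^ 4) + (1 / (2 * 1)) * CG)
        + (1 / σ₀) * (c₁ / (f y₂ 5 - f y₁ 5) *
          ((1 / (4 * Real.pi * σ₀) ^ 2) * ρ * ((κ / 2) * (ξ * (CA * ρ ^ 4)) + CA * ρ ^ 4 / (2 * κ))
            + 32 * Real.sqrt σ₁ * Real.exp (-(1 / 2)) * Real.exp (-ρ ^ 2 / (16 * σ₁)) * CG)))
        * σ₁ ≤ δ₀ / 16) : False := by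
  set g₁ := (euclideanMetric (EuclideanSpace ℝ (Fin 6))).inducedRiemannianMetric f
    contMDiff_pullbackBilin_holds hf with hg₁
  set μ := riemannianMeasure g₁ with hμ
  set Hm : M → ℝ := fun w => (euclideanMetric (EuclideanSpace ℝ (Fin 6))).meanCurvature f
    contMDiff_pullbackBilin_holds hf νf w with hHm
  set g : ℝ := f y₂ 5 - f y₁ 5 with hgdef
  set KH : ℝ := 2048 * Real.exp (1 / 16) * (θ * CA) / Real.pi ^ 2 + W / R₀ ^ 4 with hKH
  have hg : 0 < g := by rw [hgdef]; linarith
  have hσ₁ : 0 < σ₁ := lt_of_lt_of_le hσ₀ hσ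
  have hπ := Real.pi_pos
  -- the Willmore energy and the constants are non-negative
  have hW0 : 0 ≤ W := le_trans (integral_nonneg fun w => sq_nonneg _) hW
  have hKH0 : 0 ≤ KH := by positivity
  have hAtot0 : 0 ≤ Atot := le_trans measureReal_nonneg hAtot
  have hCG0 : 0 ≤ CG := le_trans (by positivity) hCG
  -- the midpoint
  obtain ⟨hpsh, hx₁, hx₂⟩ := midpoint_vertical (f y₁) (f y₂) hsh
  set p : EuclideanSpace ℝ (Fin 6) := f y₁ + (g / 2) • EuclideanSpace.single (5 : Fin 6) (1 : ℝ) with hp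
  rw [abs_of_pos hg] at hx₁ hx₂
  have hpN : ∑ i : Fin 5, p (Fin.castSucc i) ^ 2 = 1 := by
    rw [← hN y₁]
    exact Finset.sum_congr rfl fun i _ => by rw [hpsh i]
  -- the cutoffs
  obtain ⟨u, hu, hu01, hu1, hu2, hulow, huhigh⟩ := hcut (f y₂ 5 - g / 3) g hg
  obtain ⟨hv, hv01, hv1, hv2⟩ := one_sub_heightCutoff hu hu01 hu1 hu2
  have hufar : ∀ t, |t - f y₁ 5| < g / 3 → u t = 1 := fun t ht => by
    apply hulow
    rw [abs_lt] at ht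
    rw [hgdef] at ht ⊢
    linarith [ht.2]
  have hvfar : ∀ t, |t - f y₂ 5| < g / 3 → 1 - u t = 1 := fun t ht => by
    rw [huhigh t, sub_zero]
    rw [abs_lt] at ht
    linarith [ht.1]
  -- goodness at the two points
  have hg₁ := hgood y₁ (by simp)
  have hg₂ := hgood y₂ (by simp)
  -- Ahlfors growth at the two centres
  have hgr₁ : ∀ r, 0 < r → r ≤ R₀ → μ.real (f ⁻¹' Metric.closedBall (f y₁) r) ≤ CA * r ^ 4 :=
    hAhl (f y₁) (hN y₁)
  have hgr₂ : ∀ r, 0 < r → r ≤ R₀ → μ.real (f ⁻¹' Metric.closedBall (f y₂) r) ≤ CA * r ^ 4 :=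
    hAhl (f y₂) (hN y₂)
  -- Gaussian-weighted Willmore and mass bounds at the two centres, all scales
  have hKH₁ : ∀ s, 0 < s → ∫ w, (Real.exp (-‖f w - f y₁‖ ^ 2 / (4 * s)) / (4 * Real.pi * s) ^ 2) *
      Hm w ^ 2 ∂μ ≤ KH := by
    intro s hs
    refine le_trans (gaussianWillmore_le_of_ballGoodness hf hν (f y₁) hs hR₀ hCA hθ hgr₁
      (fun r hr hrR => (hg₁ r hr hrR).2)) ?_
    rw [hKH]
    gcongr
  have hKH₂ : ∀ s, 0 < s → ∫ w, (Real.exp (-‖f w - f y₂‖ ^ 2 / (4 * s)) / (4 * Real.pi * s) ^ 2) *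
      Hm w ^ 2 ∂μ ≤ KH := by
    intro s hs
    refine le_trans (gaussianWillmore_le_of_ballGoodness hf hν (f y₂) hs hR₀ hCA hθ hgr₂
      (fun r hr hrR => (hg₂ r hr hrR).2)) ?_
    rw [hKH]
    gcongr
  have hCG₁ : ∀ s, 0 < s → ∫ w, Real.exp (-‖f w - f y₁‖ ^ 2 / (4 * s)) / (4 * Real.pi * s) ^ 2 ∂μ ≤ CG := by
    intro s hs
    refine le_trans (gaussianMass_le_of_ballGrowth hf (f y₁) hs hR₀ hCA hgr₁) (le_trans ?_ hCG)
    gcongr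
  have hCG₂ : ∀ s, 0 < s → ∫ w, Real.exp (-‖f w - f y₂‖ ^ 2 / (4 * s)) / (4 * Real.pi * s) ^ 2 ∂μ ≤ CG := by
    intro s hs
    refine le_trans (gaussianMass_le_of_ballGrowth hf (f y₂) hs hR₀ hCA hgr₂) (le_trans ?_ hCG)
    gcongr
  -- near tilt and near mass at radius `ρ`
  have hT₁ : ∫ w in f ⁻¹' Metric.closedBall (f y₁) ρ, (∑ i : Fin 5, νf w (Fin.castSucc i) ^ 2) ∂μ ≤
      ξ * (CA * ρ ^ 4) :=
    le_trans (hg₁ ρ hρ hρR).1 (mul_le_mul_of_nonneg_left (hgr₁ ρ hρ hρR) hξ.le)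
  have hT₂ : ∫ w in f ⁻¹' Metric.closedBall (f y₂) ρ, (∑ i : Fin 5, νf w (Fin.castSucc i) ^ 2) ∂μ ≤
      ξ * (CA * ρ ^ 4) :=
    le_trans (hg₂ ρ hρ hρR).1 (mul_le_mul_of_nonneg_left (hgr₂ ρ hρ hρR) hξ.le)
  have hA₁ : μ.real (f ⁻¹' Metric.closedBall (f y₁) ρ) ≤ CA * ρ ^ 4 := hgr₁ ρ hρ hρR
  have hA₂ : μ.real (f ⁻¹' Metric.closedBall (f y₂) ρ) ≤ CA * ρ ^ 4 := hgr₂ ρ hρ hρR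
  -- the cut pieces
  have hcut₁ := cutPiece_twoScale hf hν hun hN hνN (f y₁) hσ₀ hσ hρ.le hg one_pos hκ hu hu01 hu1 hu2
    hufar (fun s hs => hKH₁ s (lt_of_lt_of_le hσ₀ hs.1))
    (fun s hs => hCG₁ s (lt_of_lt_of_le hσ₀ hs.1)) hT₁ hA₁
  have hcut₂ := cutPiece_twoScale hf hν hun hN hνN (f y₂) hσ₀ hσ hρ.le hg one_pos hκ hv hv01 hv1 hv2
    hvfar (fun s hs => hKH₂ s (lt_of_lt_of_le hσ₀ hs.1))
    (fun s hs => hCG₂ s (lt_of_lt_of_le hσ₀ hs.1)) hT₂ hA₂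
  -- the unit initial densities
  have hKH4 : 0 ≤ KH / 4 := by positivity
  have hinit₁ := initialDensity_ge hf hemb hν hun hN hνN y₁ hσ₀ hKH4
    (fun s hs _ => by
      have := hKH₁ s hs
      linarith)
  have hinit₂ := initialDensity_ge hf hemb hν hun hN hνN y₂ hσ₀ hKH4
    (fun s hs _ => by
      have := hKH₂ s hs
      linarith)
  -- the midpoint comparison
  have hmid := midpoint_density_ge hf hu.continuous hv.continuous (fun t => (hu01 t).1)
    (fun t => (hv01 t).1) (fun t => by ring) (f y₁) (f y₂) p (g := g) hσ₁ hη hx₁.le hx₂.le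
  -- the upper bound at the midpoint
  have hτ0 : 0 < (1 + η) * σ₁ := mul_pos (by linarith) hσ₁
  have hP := hup p hpN ((1 + η) * σ₁) hτ0 hτ
  -- mass bounds at `2σ₀`
  have hC₁ := hCG₁ (2 * σ₀) (by positivity)
  have hC₂ := hCG₂ (2 * σ₀) (by positivity)
  -- the contradiction
  refine stacking_arith hσ₀.le hδ₀ hδ₁ ?_ (Real.exp_pos _).le hcut₁ hcut₂ hinit₁ hinit₂ hC₁ hC₂ hmid hP
    hm hE ha hK
  -- `0 ≤ K⋆`
  have hc₁ : 0 ≤ c₁ / g := le_trans (abs_nonneg _) (hu1 0)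
  have hc₂ : 0 ≤ c₂ / g ^ 2 := le_trans (abs_nonneg _) (hu2 0)
  positivity

end Summit.SmoothPoincare4.SmoothPoincare4.Cruxes.CylinderRungTwo.KillingFlux

end
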